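import Mathlib
import Literature.MathematicalPhysics.QuantumFieldTheory.Balaban1983to89.B5Prop12Chain

/-!
# B5 p. 36: «The localized inequalities (1.110)–(1.114) imply immediately the following global
# inequalities (1.115)–(1.117)» — the summation over unit cubes, KERNEL-CHECKED over located leaves

Source: T. Bałaban, *Propagators and renormalization transformations for lattice gauge theories. I*,
Commun. Math. Phys. **95** (1984) 17–40 (`Balaban1984PropagatorsI`, "B5"), Sect. F, pp. 35–36
[PDF 19–20]; renders `b2b-balaban-ref1/pages/1984-cmp95-propagators-rt-I/…-p019-x2.png` (journal p. 35)
and `…-p020-x2.png` (journal p. 36) read as images this session.  A typed skeleton of PUBLISHED work under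
line-by-line audit by the pub-balaban cell; value = kernel-checked bookkeeping edge + located leaves, NOT
summit progress.

## What the paper prints (verbatim)

p. 35: «|A| = max_μ sup_x |A_μ(x)|, |∇A| = max_{μ,ν} sup_x |(∂_μA_ν)(x)|, (1.108) and the Hölder norm
‖A‖_α = max_μ sup_{x,x′:|x−x′|≤1} (1/|x − x′|^α)|A_μ(x) − A_μ(x′)|, … (1.109)»;
«To describe decay properties we use two families of cubes, both parametrized by points of the unit
lattice T₁^{(k)}. Cubes Δ(y) are simply unit cubes of T_η, or Δ(y) = B^k(y), y ∈ T₁^{(k)}. Cubes Δ̃(y) are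
sums of 2^d unit cubes having the point y as a corner, thus they are cubes of size 2 and with a center
at y.»; Prop. 1.2 (1.110): «for x ∈ Δ̃(y), supp J ⊂ Δ̃(y′)».

p. 36: «The localized inequalities (1.110)–(1.114) imply immediately the following global inequalities
|GJ|, |∇GJ|, |G∇*J|, |ΔGJ|, ‖∇GJ‖_α, ‖G∇*J‖_α ≤ O(1)|J|, (1.115)
|∇G∇*J| ≤ O(1)(‖J‖_ε + |J|), (1.116)
‖∇G∇*J‖_α ≤ O(1)(‖J‖_{α+ε} + |J|), (1.117)
and (1.89), with the same dependence of the constants O(1).»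

## What is typed and certified here (kernel-checked, zero sorry)

The word «immediately» unfolded, over the abstract `B5.Setting` of gen 1 (`B5.Prop12Printed` =
(1.110)–(1.114) as the family statement `Ineq110_114`, `B5.Global115_117Fam` = (1.115)–(1.117)):

* `GlobCover S g cP cζ cG` — the LOCATED LEAVES of the summation (model-evident on T_η with unit cubes,
  none of them a torus computation done here): a finite index set `T1` of unit-lattice points y′; a
  decomposition `piece J y′` = ζ′_{y′}J of every J by a smooth unit-scale partition of unity subordinate to
  the cubes Δ̃(y′) (`piece_supp`), with |ζ′_{y′}J| ≤ |J| (`piece_sup`) and ‖ζ′_{y′}J‖_ε ≤ c_P(‖J‖_ε + |J|)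
  (`piece_holder`); cutoffs ζ_y ∈ C₀^∞(Δ̃(y)) (`cut_in`) with ‖ζ_y‖_α + |ζ_y| ≤ c_ζ (`cutH_le`);
  subadditivity of the four kinds of local entries in J over the decomposition (`e_sub`, `h1_sub`,
  `e4_sub`, `h2_sub`: linearity of G, ∇G, G∇*, ΔG, ∇G∇* and the triangle inequality for sup norms and
  Hölder seminorms); and the passage from the localised functionals to the global ones of `B5.GlobalH`
  (`hg1_le`, `hg2_le`: ‖f‖_α ≤ c_G(sup_y ‖ζ_yf‖_α + |f|), pairs |x − x′| ≤ 1 not inside one plateau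
  {ζ_y = 1} being paid by |f|; `e4g_le`: the global sup is the sup over y of the sups over Δ̃(y)).
* `global_inst` — ONE instance: `Ineq110_114 S C Cα Cε Cαε δ₀` + a cover + row sums
  Σ_{y′∈T1} e^{−δ₀|y−y′|} ≤ Λ ⟹ `Global115_117 S g` with the EXPLICIT constants
  C·Λ + 1, c_G(max(C_α,0)c_ζΛ + CΛ + 1), max(C_ε,0)(c_P + 1)Λ,
  c_G(max(C_{α,ε},0)c_ζ(c_P + 1)Λ + max(C_ε(α+ε),0)(c_P + 1)Λ)  (the printed «same dependence of the
  constants»; the clipping max(·,0) only records that a printed O(1) is used as a nonnegative number).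
* `global_of_prop12` — the FAMILY statement, constants chosen before the instance:
  `B5.Prop12Printed fam → B5.Global115_117Fam fam g`, given covers, sign facts and unit-lattice row sums
  uniform in the family (`hRow`, the same model-evident input as `B5Transfer133.URow`).
* `S2_via132` — the printed step S2 of `B5.prop12_of_printed_steps` DISCHARGED:
  `Prop12Printed famG0 → Kernel126_127Printed Kd → Local114Fam fam → Global115_117Fam fam g`, by gen 3's
  (1.132) transfer `B5Transfer132.prop12_of_G0_via132` followed by `global_of_prop12`.
* `global_via132_walk` — (1.115)–(1.117) for G from Prop. 1.1 for G, the leaf (1.126)–(1.127), S3 =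
  Prop. 1.2 for G₀ and the located leaves of gens 3–4 (`B5Prop12Chain.prop12_via132_walk`), then
  `global_of_prop12`.

After this file the four printed-step slots of `B5.prop12_of_printed_steps` stand as follows: S1′
(`B5Local114`), S2 (here), S3 (`B5Transfer133`, from B4) are kernel terms over located leaves; S1 (the
Hölder-norm walk (1.115)–(1.117), (1.89) ⟹ (1.110)–(1.113)) is not typed and is not needed for
`B5.Prop12Printed fam`, which gen 3 reaches directly through (1.132).

## What this file does NOT claim

No torus computation: the partition of unity, the cutoffs, the seminorm inequalities and the row sums
are hypotheses of printed / model-evident shape (GAPS G-B5-26), exactly as in gens 2–4.  (1.89) («and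
(1.89)») is Prop. 1.1 itself and is not restated.  DEVIATIONS: none (constants made explicit only).
-/

namespace Literature.MathematicalPhysics.QuantumFieldTheory.Balaban1983to89.B5Global115

open Finset B5FromB4 B5Transfer133 B5Transfer132 B5Local114 B5Prop12Chain

noncomputable section

/-! ## 1. The located leaves of the summation over unit cubes -/

/-- **Located leaves of «imply immediately» (p. 36)**, for one instance (k, T_η): a finite set `T1` of
unit-lattice points; the decomposition J = Σ_{y′∈T1} ζ′_{y′}J by a smooth unit-scale partition of unity with
supp ζ′_{y′} ⊂ Δ̃(y′) («Cubes Δ̃(y) are sums of 2^d unit cubes having the point y as a corner», p. 35) —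
`piece`, `piece_supp`, `piece_sup` (|ζ′J| ≤ |J|), `piece_holder` (‖ζ′J‖_ε ≤ c_P(‖J‖_ε + |J|), unit-scale
bumps, uniform in η); cutoffs ζ_y ∈ C₀^∞(Δ̃(y)) — `cut`, `cut_in`, `cutH_le` (‖ζ_y‖_α + |ζ_y| ≤ c_ζ for
0 ≤ α < 1); subadditivity in J of the local entries of (1.110)–(1.113) over the finite decomposition —
`e_sub`, `h1_sub`, `e4_sub`, `h2_sub` (linearity of the six operators + triangle inequality for the sup
norm (1.108) and the Hölder seminorm (1.109)); globalisation — `hg1_le`, `hg2_le` (‖f‖_α ≤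
c_G(sup_y‖ζ_yf‖_α + |f|): a pair x, x′ with |x − x′| ≤ 1 either lies in a plateau {ζ_y = 1} or is paid by
2·4^α|f|), `e4g_le` (|f| = sup_y sup_{x∈Δ̃(y)}|f(x)|).  Model-evident on the torus; NOT proved here
(GAPS G-B5-26). [cite: Balaban1984PropagatorsI, (1.108)–(1.110) p.35, (1.115)–(1.117) p.36] -/
structure GlobCover (S : B5.Setting) (g : B5.GlobalH S) (cP cζ cG : ℝ) where
  T1 : Finset S.Site
  piece : S.Loc → S.Site → S.Loc
  cut : S.Site → S.Cut
  piece_supp : ∀ (J : S.Loc) (y' : S.Site), S.suppIn (piece J y') y'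
  cut_in : ∀ y : S.Site, S.cutIn (cut y) y
  piece_sup : ∀ (J : S.Loc) (y' : S.Site), S.supNorm (piece J y') ≤ S.supNorm J
  piece_holder : ∀ (ε : ℝ) (J : S.Loc) (y' : S.Site), 0 < ε → ε < 1 →
    S.holder ε (piece J y') ≤ cP * (S.holder ε J + S.supNorm J)
  cutH_le : ∀ (α : ℝ) (y : S.Site), 0 ≤ α → α < 1 → S.cutH α (cut y) ≤ cζ
  e_sub : ∀ (n : Fin 4) (J : S.Loc) (y : S.Site), S.e n J y ≤ ∑ y' ∈ T1, S.e n (piece J y') y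
  h1_sub : ∀ (J : S.Loc) (α : ℝ) (y : S.Site), 0 ≤ α → α < 1 →
    S.h1 J α (cut y) ≤ ∑ y' ∈ T1, S.h1 (piece J y') α (cut y)
  e4_sub : ∀ (J : S.Loc) (y : S.Site), S.e4 J y ≤ ∑ y' ∈ T1, S.e4 (piece J y') y
  h2_sub : ∀ (J : S.Loc) (α : ℝ) (y : S.Site), 0 ≤ α → α < 1 →
    S.h2 J α (cut y) ≤ ∑ y' ∈ T1, S.h2 (piece J y') α (cut y)
  hg1_le : ∀ (J : S.Loc) (α B B' : ℝ), 0 ≤ α → α < 1 → 0 ≤ B → 0 ≤ B' →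
    (∀ y : S.Site, S.h1 J α (cut y) ≤ B) → (∀ (n : Fin 4) (y : S.Site), S.e n J y ≤ B') →
    g.hg1 J α ≤ cG * (B + B')
  e4g_le : ∀ (J : S.Loc) (B : ℝ), 0 ≤ B → (∀ y : S.Site, S.e4 J y ≤ B) → g.e4g J ≤ B
  hg2_le : ∀ (J : S.Loc) (α B B' : ℝ), 0 ≤ α → α < 1 → 0 ≤ B → 0 ≤ B' →
    (∀ y : S.Site, S.h2 J α (cut y) ≤ B) → (∀ y : S.Site, S.e4 J y ≤ B') →
    g.hg2 J α ≤ cG * (B + B')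

/-! ## 2. One instance: summing (1.110)–(1.113) over y′ -/

/-- Summation bookkeeping: termwise bounds f(y′) ≤ w(y′)·a with Σ w ≤ Λ and a ≥ 0 give Σ f ≤ Λ·a
(the abstract form of «Σ_{y′} O(1)e^{−δ₀|y−y′|}·(…) ≤ O(1)·(…)»). [folklore] -/
theorem sum_decay_le {ι : Type*} (T : Finset ι) (w f : ι → ℝ) (Λ a : ℝ)
    (hΛ : ∑ y ∈ T, w y ≤ Λ) (ha : 0 ≤ a) (hf : ∀ y ∈ T, f y ≤ w y * a) :
    ∑ y ∈ T, f y ≤ Λ * a := by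
  calc ∑ y ∈ T, f y ≤ ∑ y ∈ T, w y * a := Finset.sum_le_sum hf
    _ = (∑ y ∈ T, w y) * a := by rw [Finset.sum_mul]
    _ ≤ Λ * a := mul_le_mul_of_nonneg_right hΛ ha

variable {S : B5.Setting} {g : B5.GlobalH S} {cP cζ cG : ℝ}

/-- **(1.110)–(1.113) ⟹ (1.115)–(1.117) for ONE instance**, with explicit constants: given the localised
inequalities `B5.Ineq110_114 S C Cα Cε Cαε δ₀`, a cover (`GlobCover`), the sign facts of the model and the
unit-lattice row sums Σ_{y′∈T1} e^{−δ₀|y−y′|} ≤ Λ, the global inequalities `B5.Global115_117 S g` hold with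
constants C·Λ + 1 (sup entries), c_G(max(C_α,0)c_ζΛ + CΛ + 1) (‖∇GJ‖_α, ‖G∇*J‖_α), max(C_ε,0)(c_P+1)Λ
(|∇G∇*J|), c_G(max(C_{α,ε},0)c_ζ(c_P+1)Λ + max(C_ε(α+ε),0)(c_P+1)Λ) (‖∇G∇*J‖_α) — «with the same
dependence of the constants O(1)» (p. 36).  Kernel arithmetic: decompose J, apply the localised bound to
each piece, sum the exponentials. [cite: Balaban1984PropagatorsI, (1.115)–(1.117) p.36] -/
theorem global_inst (D : GlobCover S g cP cζ cG) (Sg : ModelSigns S) (hcP : 0 ≤ cP) (hcζ : 0 ≤ cζ)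
    {C δ₀ Λ : ℝ} {Cα Cε : ℝ → ℝ} {Cαε : ℝ → ℝ → ℝ} (hC : 0 ≤ C)
    (h : B5.Ineq110_114 S C Cα Cε Cαε δ₀)
    (hΛ : ∀ y : S.Site, ∑ y' ∈ D.T1, Real.exp (-(δ₀ * S.dist y y')) ≤ Λ) (hΛ0 : 0 ≤ Λ) :
    B5.Global115_117 S g (C * Λ + 1)
      (fun α => cG * (max (Cα α) 0 * cζ * Λ + (C * Λ + 1)))
      (fun ε => max (Cε ε) 0 * (cP + 1) * Λ)
      (fun α ε => cG * (max (Cαε α ε) 0 * cζ * (cP + 1) * Λ + max (Cε (α + ε)) 0 * (cP + 1) * Λ)) := by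
  obtain ⟨h1c, h2c, h3c, h4c, -⟩ := h
  -- (1.110) summed: the four sup entries
  have step1 : ∀ (n : Fin 4) (J : S.Loc) (y : S.Site), S.e n J y ≤ (C * Λ + 1) * S.supNorm J := by
    intro n J y
    have hsJ := Sg.supNorm_nonneg J
    have hsum : ∑ y' ∈ D.T1, S.e n (D.piece J y') y ≤ Λ * (C * S.supNorm J) := by
      refine sum_decay_le D.T1 (fun y' => Real.exp (-(δ₀ * S.dist y y')))
        (fun y' => S.e n (D.piece J y') y) Λ (C * S.supNorm J) (hΛ y) (by positivity) ?_
      intro y' _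
      have hb := h1c n (D.piece J y') y y' (D.piece_supp J y')
      have he : 0 ≤ Real.exp (-(δ₀ * S.dist y y')) := (Real.exp_pos _).le
      calc S.e n (D.piece J y') y
          ≤ C * Real.exp (-(δ₀ * S.dist y y')) * S.supNorm (D.piece J y') := hb
        _ ≤ C * Real.exp (-(δ₀ * S.dist y y')) * S.supNorm J :=
            mul_le_mul_of_nonneg_left (D.piece_sup J y') (mul_nonneg hC he)
        _ = Real.exp (-(δ₀ * S.dist y y')) * (C * S.supNorm J) := by ring
    have := (D.e_sub n J y).trans hsum
    rw [add_mul, one_mul]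
    linarith
  -- (1.112) summed, per y (used for (1.116) and inside (1.117))
  have step3 : ∀ (ε : ℝ) (J : S.Loc) (y : S.Site), 0 < ε → ε < 1 →
      S.e4 J y ≤ Λ * (max (Cε ε) 0 * (cP + 1) * (S.holder ε J + S.supNorm J)) := by
    intro ε J y hε hε1
    have hsJ := Sg.supNorm_nonneg J
    have hhJ := Sg.holder_nonneg ε J
    refine (D.e4_sub J y).trans ?_
    refine sum_decay_le D.T1 (fun y' => Real.exp (-(δ₀ * S.dist y y')))
      (fun y' => S.e4 (D.piece J y') y) Λ _ (hΛ y) (by positivity) ?_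
    intro y' _
    have hb := h3c ε (D.piece J y') y y' hε hε1 (D.piece_supp J y')
    have he : 0 ≤ Real.exp (-(δ₀ * S.dist y y')) := (Real.exp_pos _).le
    have hW0 : 0 ≤ S.holder ε (D.piece J y') + S.supNorm (D.piece J y') :=
      add_nonneg (Sg.holder_nonneg ε _) (Sg.supNorm_nonneg _)
    have hW : S.holder ε (D.piece J y') + S.supNorm (D.piece J y') ≤
        (cP + 1) * (S.holder ε J + S.supNorm J) := by
      have h1 := D.piece_holder ε J y' hε hε1
      have h2 := D.piece_sup J y'
      nlinarith
    calc S.e4 (D.piece J y') y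
        ≤ Cε ε * Real.exp (-(δ₀ * S.dist y y')) * (S.holder ε (D.piece J y') + S.supNorm (D.piece J y')) :=
          hb
      _ ≤ max (Cε ε) 0 * Real.exp (-(δ₀ * S.dist y y')) *
            (S.holder ε (D.piece J y') + S.supNorm (D.piece J y')) :=
          mul_le_mul_of_nonneg_right (mul_le_mul_of_nonneg_right (le_max_left _ _) he) hW0
      _ ≤ max (Cε ε) 0 * Real.exp (-(δ₀ * S.dist y y')) * ((cP + 1) * (S.holder ε J + S.supNorm J)) :=
          mul_le_mul_of_nonneg_left hW (mul_nonneg (le_max_right _ _) he)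
      _ = Real.exp (-(δ₀ * S.dist y y')) * (max (Cε ε) 0 * (cP + 1) * (S.holder ε J + S.supNorm J)) := by
          ring
  refine ⟨step1, ?_, ?_, ?_⟩
  · -- (1.111) summed and globalised: ‖∇GJ‖_α, ‖G∇*J‖_α ≤ O(1)|J|
    intro α J hα hα1
    have hsJ := Sg.supNorm_nonneg J
    have hB : ∀ y : S.Site, S.h1 J α (D.cut y) ≤ Λ * (max (Cα α) 0 * cζ * S.supNorm J) := by
      intro y
      refine (D.h1_sub J α y hα hα1).trans ?_
      refine sum_decay_le D.T1 (fun y' => Real.exp (-(δ₀ * S.dist y y')))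
        (fun y' => S.h1 (D.piece J y') α (D.cut y)) Λ _ (hΛ y) (by positivity) ?_
      intro y' _
      have hb := h2c α (D.piece J y') (D.cut y) y y' hα hα1 (D.cut_in y) (D.piece_supp J y')
      have he : 0 ≤ Real.exp (-(δ₀ * S.dist y y')) := (Real.exp_pos _).le
      have hcH := Sg.cutH_nonneg α (D.cut y)
      have hsP := Sg.supNorm_nonneg (D.piece J y')
      calc S.h1 (D.piece J y') α (D.cut y)
          ≤ Cα α * Real.exp (-(δ₀ * S.dist y y')) * S.cutH α (D.cut y) * S.supNorm (D.piece J y') := hb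
        _ ≤ max (Cα α) 0 * Real.exp (-(δ₀ * S.dist y y')) * S.cutH α (D.cut y) *
              S.supNorm (D.piece J y') :=
            mul_le_mul_of_nonneg_right (mul_le_mul_of_nonneg_right
              (mul_le_mul_of_nonneg_right (le_max_left _ _) he) hcH) hsP
        _ ≤ max (Cα α) 0 * Real.exp (-(δ₀ * S.dist y y')) * cζ * S.supNorm (D.piece J y') :=
            mul_le_mul_of_nonneg_right (mul_le_mul_of_nonneg_left (D.cutH_le α y hα hα1)
              (mul_nonneg (le_max_right _ _) he)) hsP
        _ ≤ max (Cα α) 0 * Real.exp (-(δ₀ * S.dist y y')) * cζ * S.supNorm J :=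
            mul_le_mul_of_nonneg_left (D.piece_sup J y')
              (mul_nonneg (mul_nonneg (le_max_right _ _) he) hcζ)
        _ = Real.exp (-(δ₀ * S.dist y y')) * (max (Cα α) 0 * cζ * S.supNorm J) := by ring
    have hB' : ∀ (n : Fin 4) (y : S.Site), S.e n J y ≤ (C * Λ + 1) * S.supNorm J :=
      fun n y => step1 n J y
    have hfin := D.hg1_le J α _ _ hα hα1 (by positivity) (by positivity) hB hB'
    calc g.hg1 J α ≤ cG * (Λ * (max (Cα α) 0 * cζ * S.supNorm J) + (C * Λ + 1) * S.supNorm J) := hfin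
      _ = cG * (max (Cα α) 0 * cζ * Λ + (C * Λ + 1)) * S.supNorm J := by ring
  · -- (1.112) globalised: |∇G∇*J| ≤ O(1)(‖J‖_ε + |J|)
    intro ε J hε hε1
    have hsJ := Sg.supNorm_nonneg J
    have hhJ := Sg.holder_nonneg ε J
    have hfin := D.e4g_le J _ (by positivity) (fun y => step3 ε J y hε hε1)
    calc g.e4g J ≤ Λ * (max (Cε ε) 0 * (cP + 1) * (S.holder ε J + S.supNorm J)) := hfin
      _ = max (Cε ε) 0 * (cP + 1) * Λ * (S.holder ε J + S.supNorm J) := by ring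
  · -- (1.113) summed and globalised: ‖∇G∇*J‖_α ≤ O(1)(‖J‖_{α+ε} + |J|)
    intro α ε J hα hε hαε
    have hα1 : α < 1 := by linarith
    have hae0 : 0 < α + ε := by linarith
    have hsJ := Sg.supNorm_nonneg J
    have hhJ := Sg.holder_nonneg (α + ε) J
    have hB : ∀ y : S.Site, S.h2 J α (D.cut y) ≤
        Λ * (max (Cαε α ε) 0 * cζ * (cP + 1) * (S.holder (α + ε) J + S.supNorm J)) := by
      intro y
      refine (D.h2_sub J α y hα hα1).trans ?_
      refine sum_decay_le D.T1 (fun y' => Real.exp (-(δ₀ * S.dist y y')))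
        (fun y' => S.h2 (D.piece J y') α (D.cut y)) Λ _ (hΛ y) (by positivity) ?_
      intro y' _
      have hb := h4c α ε (D.piece J y') (D.cut y) y y' hα hε hαε (D.cut_in y) (D.piece_supp J y')
      have he : 0 ≤ Real.exp (-(δ₀ * S.dist y y')) := (Real.exp_pos _).le
      have hcH := Sg.cutH_nonneg α (D.cut y)
      have hW0 : 0 ≤ S.holder (α + ε) (D.piece J y') + S.supNorm (D.piece J y') :=
        add_nonneg (Sg.holder_nonneg _ _) (Sg.supNorm_nonneg _)
      have hW : S.holder (α + ε) (D.piece J y') + S.supNorm (D.piece J y') ≤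
          (cP + 1) * (S.holder (α + ε) J + S.supNorm J) := by
        have h1 := D.piece_holder (α + ε) J y' hae0 hαε
        have h2 := D.piece_sup J y'
        nlinarith
      calc S.h2 (D.piece J y') α (D.cut y)
          ≤ Cαε α ε * Real.exp (-(δ₀ * S.dist y y')) * S.cutH α (D.cut y) *
              (S.holder (α + ε) (D.piece J y') + S.supNorm (D.piece J y')) := hb
        _ ≤ max (Cαε α ε) 0 * Real.exp (-(δ₀ * S.dist y y')) * S.cutH α (D.cut y) *
              (S.holder (α + ε) (D.piece J y') + S.supNorm (D.piece J y')) :=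
            mul_le_mul_of_nonneg_right (mul_le_mul_of_nonneg_right
              (mul_le_mul_of_nonneg_right (le_max_left _ _) he) hcH) hW0
        _ ≤ max (Cαε α ε) 0 * Real.exp (-(δ₀ * S.dist y y')) * cζ *
              (S.holder (α + ε) (D.piece J y') + S.supNorm (D.piece J y')) :=
            mul_le_mul_of_nonneg_right (mul_le_mul_of_nonneg_left (D.cutH_le α y hα hα1)
              (mul_nonneg (le_max_right _ _) he)) hW0
        _ ≤ max (Cαε α ε) 0 * Real.exp (-(δ₀ * S.dist y y')) * cζ *
              ((cP + 1) * (S.holder (α + ε) J + S.supNorm J)) :=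
            mul_le_mul_of_nonneg_left hW (mul_nonneg (mul_nonneg (le_max_right _ _) he) hcζ)
        _ = Real.exp (-(δ₀ * S.dist y y')) *
              (max (Cαε α ε) 0 * cζ * (cP + 1) * (S.holder (α + ε) J + S.supNorm J)) := by ring
    have hB' : ∀ y : S.Site, S.e4 J y ≤
        Λ * (max (Cε (α + ε)) 0 * (cP + 1) * (S.holder (α + ε) J + S.supNorm J)) :=
      fun y => step3 (α + ε) J y hae0 hαε
    have hfin := D.hg2_le J α _ _ hα hα1 (by positivity) (by positivity) hB hB'
    calc g.hg2 J α
        ≤ cG * (Λ * (max (Cαε α ε) 0 * cζ * (cP + 1) * (S.holder (α + ε) J + S.supNorm J)) +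
            Λ * (max (Cε (α + ε)) 0 * (cP + 1) * (S.holder (α + ε) J + S.supNorm J))) := hfin
      _ = cG * (max (Cαε α ε) 0 * cζ * (cP + 1) * Λ + max (Cε (α + ε)) 0 * (cP + 1) * Λ) *
            (S.holder (α + ε) J + S.supNorm J) := by ring

/-! ## 3. The family statement: constants before the instance -/

/-- **p. 36, verbatim: «The localized inequalities (1.110)–(1.114) imply immediately the following global
inequalities |GJ|, |∇GJ|, |G∇*J|, |ΔGJ|, ‖∇GJ‖_α, ‖G∇*J‖_α ≤ O(1)|J|, (1.115) |∇G∇*J| ≤ O(1)(‖J‖_ε + |J|),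
(1.116) ‖∇G∇*J‖_α ≤ O(1)(‖J‖_{α+ε} + |J|), (1.117) and (1.89), with the same dependence of the constants
O(1).»** — BY TYPE, as a family statement (constants chosen before the instance i = (k, T_η)):
`B5.Prop12Printed fam → B5.Global115_117Fam fam g`, given per instance a cover (located leaves
`GlobCover`, G-B5-26) with family-uniform constants c_P, c_ζ, c_G, the sign facts of the model, and the
unit-lattice row sums Σ_{y′} e^{−κ|y−y′|} ≤ Λ(κ) uniform in the family (`hRow`).  («and (1.89)» is Prop. 1.1
itself, `B5.Prop11Printed`, not restated.) [cite: Balaban1984PropagatorsI, (1.115)–(1.117) p.36] -/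
theorem global_of_prop12 {I : Type} (fam : I → B5.Setting) (g : ∀ i, B5.GlobalH (fam i))
    {cP cζ cG : ℝ} (hcP : 0 ≤ cP) (hcζ : 0 ≤ cζ)
    (D : ∀ i, GlobCover (fam i) (g i) cP cζ cG) (Sg : ∀ i, ModelSigns (fam i))
    (hRow : ∀ κ : ℝ, 0 < κ → ∃ Λ : ℝ, ∀ (i : I) (y : (fam i).Site),
      ∑ y' ∈ (D i).T1, Real.exp (-(κ * (fam i).dist y y')) ≤ Λ) :
    B5.Prop12Printed fam → B5.Global115_117Fam fam g := by
  rintro ⟨δ₀, C, Cα, Cε, Cαε, hδ, hC, h⟩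
  obtain ⟨Λ, hΛ⟩ := hRow δ₀ hδ
  refine ⟨C * max Λ 0 + 1, fun α => cG * (max (Cα α) 0 * cζ * max Λ 0 + (C * max Λ 0 + 1)),
    fun ε => max (Cε ε) 0 * (cP + 1) * max Λ 0,
    fun α ε => cG * (max (Cαε α ε) 0 * cζ * (cP + 1) * max Λ 0 +
      max (Cε (α + ε)) 0 * (cP + 1) * max Λ 0), by positivity, fun i => ?_⟩
  exact global_inst (D i) (Sg i) hcP hcζ hC.le (h i) (fun y => (hΛ i y).trans (le_max_left _ _))
    (le_max_right _ _)

/-! ## 4. Corollaries: the slot S2, and (1.115)–(1.117) for G along the (1.132) route -/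

/-- **The printed step S2 of `B5.prop12_of_printed_steps` DISCHARGED** (p. 39 «This together with the
properties (1.126), (1.127) of ∂P∂* and (1.89), or (1.114) for the operator G implies immediately
(1.115)–(1.117), or Proposition 1.2 for G.»): Prop. 1.2 for G₀, the leaf (1.126)–(1.127) and (1.114) for
G give (1.115)–(1.117) for G — by gen 3's (1.132) transfer `B5Transfer132.prop12_of_G0_via132` (to the
localised (1.110)–(1.114) for G) followed by the summation `global_of_prop12`; hypotheses beyond the three
printed inputs are the located leaves of both steps. [cite: Balaban1984PropagatorsI, pp.36–40] -/
theorem S2_via132 {I : Type} (fam famG0 : I → B5.Setting) (Kd : I → B5.KernelData)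
    (g : ∀ i, B5.GlobalH (fam i))
    (Kf : ∀ i, Carrier133 (famG0 i) (fam i)) (Kc : ∀ i, KerCarrier (Kd i) (fam i)) {A B c₀ r0 Nn Dh : ℝ}
    (Mf : ∀ i, MapFacts (Kf i) r0 Nn) (Pf : ∀ i, PieceFacts132 (Kf i) (Kc i) A B c₀)
    (Dp : ∀ i, Display133 (Kf i) Dh) (SgG0 : ∀ i, B5FromB4.ModelSigns (famG0 i))
    (SgG : ∀ i, B5FromB4.ModelSigns (fam i))
    (hRowU : ∀ κ : ℝ, 0 < κ → ∃ Λ : ℝ, ∀ i, URow (Kf i) κ Λ)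
    {cP cζ cG : ℝ} (hcP : 0 ≤ cP) (hcζ : 0 ≤ cζ)
    (Dc : ∀ i, GlobCover (fam i) (g i) cP cζ cG)
    (hRow : ∀ κ : ℝ, 0 < κ → ∃ Λ : ℝ, ∀ (i : I) (y : (fam i).Site),
      ∑ y' ∈ (Dc i).T1, Real.exp (-(κ * (fam i).dist y y')) ≤ Λ) :
    B5.Prop12Printed famG0 → B5.Kernel126_127Printed Kd → B5.Local114Fam fam →
      B5.Global115_117Fam fam g :=
  fun S3 hleaf h114 =>
    global_of_prop12 fam g hcP hcζ Dc SgG hRow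
      (prop12_of_G0_via132 famG0 fam Kf Kd Kc Mf Pf Dp SgG0 SgG hRowU S3 hleaf h114)

/-- **(1.115)–(1.117) for G along the printed route**, all reductions kernel terms: Prop. 1.1 for G
(`h11`), the leaf (1.126)–(1.127) (`hleaf`), the L² walk for G (`B5Local114.Realisation` per instance
and cube scale, `real`), S3 = Prop. 1.2 for G₀ (`S3`), gen 3's located leaves of the (1.132) transfer, and
the cover leaves of this file ⟹ `B5.Global115_117Fam fam g`
(`B5Prop12Chain.prop12_via132_walk` then `global_of_prop12`). [cite: Balaban1984PropagatorsI, pp.36–40] -/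
theorem global_via132_walk {I : Type} (fam famG0 : I → B5.Setting) (Kd : I → B5.KernelData)
    (g : ∀ i, B5.GlobalH (fam i))
    (h11 : B5.Prop11Printed fam) (hleaf : B5.Kernel126_127Printed Kd)
    (κ : Consts)
    {V : I → ℕ → Type} [∀ i M, NormedAddCommGroup (V i M)] [∀ i M, InnerProductSpace ℝ (V i M)]
    {X : I → ℕ → Type} [∀ i M, PseudoMetricSpace (X i M)]
    {T : I → ℕ → Type} [∀ i M, Fintype (T i M)]
    (real : ∀ (i : I) (M₀ : ℕ), 1 ≤ M₀ →
      Realisation (fam i) (Kd i) M₀ κ (V i M₀) (X i M₀) (T i M₀))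
    (S3 : B5.Prop12Printed famG0)
    (Kf : ∀ i, Carrier133 (famG0 i) (fam i)) (Kc : ∀ i, KerCarrier (Kd i) (fam i)) {A B c₀ r0 Nn Dh : ℝ}
    (Mf : ∀ i, MapFacts (Kf i) r0 Nn) (Pf : ∀ i, PieceFacts132 (Kf i) (Kc i) A B c₀)
    (Dp : ∀ i, Display133 (Kf i) Dh) (SgG0 : ∀ i, B5FromB4.ModelSigns (famG0 i))
    (SgG : ∀ i, B5FromB4.ModelSigns (fam i))
    (hRowU : ∀ κ' : ℝ, 0 < κ' → ∃ Λ : ℝ, ∀ i, URow (Kf i) κ' Λ)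
    {cP cζ cG : ℝ} (hcP : 0 ≤ cP) (hcζ : 0 ≤ cζ)
    (Dc : ∀ i, GlobCover (fam i) (g i) cP cζ cG)
    (hRow : ∀ κ' : ℝ, 0 < κ' → ∃ Λ : ℝ, ∀ (i : I) (y : (fam i).Site),
      ∑ y' ∈ (Dc i).T1, Real.exp (-(κ' * (fam i).dist y y')) ≤ Λ) :
    B5.Global115_117Fam fam g :=
  global_of_prop12 fam g hcP hcζ Dc SgG hRow
    (prop12_via132_walk fam famG0 Kd h11 hleaf κ real S3 Kf Kc Mf Pf Dp SgG0 SgG hRowU)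

end

end Literature.MathematicalPhysics.QuantumFieldTheory.Balaban1983to89.B5Global115
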